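import Summits.CriticalPhenomena.PercolationContinuityZ3.Theorems.Transplant.PlanarSkeletonFrmFromDefs
import Summits.CriticalPhenomena.PercolationContinuityZ3.Theorems.Transplant.SkelFrmFromBParamsBridgeF
import Summits.CriticalPhenomena.PercolationContinuityZ3.Theorems.Transplant.SkelFrmBParamsBridgeF
import Summits.CriticalPhenomena.PercolationContinuityZ3.Theorems.Transplant.SkelFrmFromBParamsSlotsT
import Summits.CriticalPhenomena.PercolationContinuityZ3.Theorems.Transplant.SkelFrmBParamsSlotsT
import HarnessLib
import Summits.CriticalPhenomena.PercolationContinuityZ3.Theorems.Transplant.SkelFrmBParamsSlotsF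
/-!
# U-WAVE PORT (RULING D-U, lead g21 2026-08-26; WAVE-U-MANIFEST v3.1 row «SkelFrmBParamsSlotsF» ↦ «SkelFrmFromBParamsSlotsF») of the tree module
# `Transplant/SkelFrmBParamsSlotsF` onto the carrier `PlanarSkeletonFrmFrom` (frames only, cylinders connected from width `ℓ₀` on)

ORIGINAL TITLE: N2 (frames-only node `SamePDropOfSkeletonFrmFrom₁`, OPEN), (F) value layer — part SlotsF: **THE WIDE BRIDGE'S SIZE `KS.SF c mk := nBF + ℓBF + |hBF|`, ITS BOX

builds on p205010 (kernel theorem, internal audit signed; external expert review pending) — nothing in this file uses p205010; NOTHING is claimed about the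
OPEN node U `SamePDropOfSkeletonFrmFrom₁` (nor U_s / the end state).  Lane `prim-bschramm`, seat `prim-bschramm-stmt` gen 26 (port pen, RULING M-11 family P-stmt; tool = p3-g26's port_u.py of record, registry-driven inputs); helper file
(`--supports stmt-CriticalPhenomena-4575 --as helper`).  PORT RULES r1–r4 of RULING D-U: declaration order and proof texts are those of the original,
byte-identical except (i) the carrier token `PlanarSkeletonFrm ↦ PlanarSkeletonFrmFrom` (binders, `namespace`/`end` lines, qualified names of twinned
declarations), (ii) carrier-FREE declarations of the original (φ-level `Skelφ…` blocks and namespace-only arithmetic residents) are NOT re-declared —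
this file imports the original and `export`s the twin-free residents (POLICY T / treatment (m1)); residents whose statement mentions a twinned
constant are copied, (iii) every carrier-binding declaration keeps its explicit binder `(Φ : PlanarSkeletonFrmFrom G)` in its own signature (r2).  Docstrings and citations are the original's.
-/

noncomputable section

open scoped Classical

namespace Summit.CriticalPhenomena.PercolationContinuityZ3.Theorems.Transplant

namespace PlanarSkeletonFrmFrom

namespace NegB

open Literature.Probability.Percolation Literature.Probability.LatticeModels SimpleGraph
open SkelConc (Consts)
open Neg

namespace KS

/-- **The wide bridge's size** `S_F := nBF + ℓBF + |hBF|`. [this work] -/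
def SF (κ : Consts) {V : Type} [DecidableEq V] [Countable V] {G : SimpleGraph V} [G.LocallyFinite] (Φ : PlanarSkeletonFrmFrom G) (t : V) (p : unitInterval)
    (D : Skelφ.StepI.DataNS V) (c mk : ℕ) : ℕ :=
  nBF κ Φ t p D c mk + ℓBF κ Φ t p D c mk + (hBF κ Φ t p D c mk).natAbs

/-- **The face's box residual** `gxF c := 64·S_F` (kit index `0` for the sizes, as N1). [this work] -/
def gxF (c : ℕ) : Neg.FSlot := fun κ _ _ _ _ _ Φ t p D => 64 * SF κ Φ t p D c 0

/-- **The face floors at `g := gT mk gx` for every box residual `gx ≥ gxF c`**: `64·S_F ≤ M_L` and `16·S_F ≤ M_L` (the y′-face origin's Λ-bounds). [folklore] -/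
theorem SF_floor_of (κ : Consts) {V : Type} [DecidableEq V] [Countable V] {G : SimpleGraph V} [G.LocallyFinite] (Φ : PlanarSkeletonFrmFrom G) (t : V) (p : unitInterval)
    (D : Skelφ.StepI.DataNS V) (c mk : ℕ) (gx : Neg.FSlot) (hgx : gxF c κ Φ t p D ≤ gx κ Φ t p D) :
    64 * SF κ Φ t p D c 0 ≤ ML κ Φ t p D (gT mk gx κ Φ t p D) ∧ 16 * SF κ Φ t p D c 0 ≤ ML κ Φ t p D (gT mk gx κ Φ t p D) := by
  have h3 := (ML_floorsT κ Φ t p D mk gx).2.2.2.1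
  have e : gxF c κ Φ t p D = 64 * SF κ Φ t p D c 0 := rfl
  rw [e] at hgx
  exact ⟨hgx.trans h3, by omega⟩

/-- **The face floors at the face's own residual** `g := gT mk (gxF c)`. [folklore] -/
theorem SF_floor (κ : Consts) {V : Type} [DecidableEq V] [Countable V] {G : SimpleGraph V} [G.LocallyFinite] (Φ : PlanarSkeletonFrmFrom G) (t : V) (p : unitInterval)
    (D : Skelφ.StepI.DataNS V) (c mk : ℕ) :
    64 * SF κ Φ t p D c 0 ≤ ML κ Φ t p D (gT mk (gxF c) κ Φ t p D) ∧ 16 * SF κ Φ t p D c 0 ≤ ML κ Φ t p D (gT mk (gxF c) κ Φ t p D) :=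
  SF_floor_of κ Φ t p D c mk (gxF c) le_rfl

end KS

end NegB

end PlanarSkeletonFrmFrom

end Summit.CriticalPhenomena.PercolationContinuityZ3.Theorems.Transplant

end
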